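import Mathlib.Data.Real.Basic
import Mathlib.Tactic.Linarith
import Mathlib.Tactic.Ring
import Mathlib.Tactic.Positivity
import HarnessLib
import HarnessLib.Audit

/-!
# `NoHeavyLowerTail` (crux stmt-CriticalPhenomena-4575), Sahi programme P4: the packing kernel of the principal block OR-step
# (block OR-step, file 2 — real inequalities)

Support file (cell `prim-l12`, seat P4, generation 15; `--supports stmt-CriticalPhenomena-4575`).  No named facts, no sorries;
standard axioms; def-free.

The KERNEL `K(x,y) = (xy − p(q−x)(q−y))⁺ = max (x*y - p*((q-x)*(q-y))) 0` on the box `[0,q]²` (`0 ≤ p ≤ 1`; in the application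
`p` is the weight of the top of the block and `q = 1 − p`): it is grounded (`K(0,y) = K(x,0) = 0`), monotone and 2-increasing
(`kernel_zero_left/right`, `kernel_mono_left`, `kernel_two_incr` via `max_two_incr`), dominated by `xy` with defect
`xy − K(x,y) ≤ p(q−x)(q−y)` (`kernel_le_mul`, `mul_sub_kernel_le`, `mul_sub_kernel_le'`).  POINTWISE CONSEQUENCES OF HARRIS'
INEQUALITY ON THE BLOCK: if `a, a' ∈ {0,1}`, `0 ≤ f ≤ q a`, `0 ≤ f' ≤ q a'`, `0 ≤ h ≤ f, f'` and `(pa+f)(pa'+f') ≤ p·aa' + h` (`p+q=1`),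
then `K(f,f') ≤ q h` (`hb_kernel_le`), `(ff' − qh)⁺ ≤ p·aa'(q−f)(q−f')` (`hb_excess_le`) and `aa'(q−f)(q−f') ≤ q·aa' + h − af' − a'f`
(`hb_m0_ge`).  These are the pointwise facts behind the packing of the pair inequality of the flat composite certificate
(`…SahiE3BlockPair`).  HOME prim-l12-p4/FROM-prim-l12-p4-gen15-BLOCK-OR-STEP.md.
-/

namespace Summit.CriticalPhenomena.PercolationContinuityZ3.Theorems.SahiE3BlockKernel

/-! ### The kernel -/

/-- `K(0,y) = 0` on `[0,q]`. [this work] -/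
theorem kernel_zero_left {p q y : ℝ} (hp : 0 ≤ p) (hy0 : 0 ≤ y) (hyq : y ≤ q) :
    max (0 * y - p * ((q - 0) * (q - y))) 0 = 0 := by
  apply max_eq_right
  have : 0 ≤ p * ((q - 0) * (q - y)) := mul_nonneg hp (mul_nonneg (by linarith) (by linarith))
  linarith

/-- `K(x,0) = 0` on `[0,q]`. [this work] -/
theorem kernel_zero_right {p q x : ℝ} (hp : 0 ≤ p) (hx0 : 0 ≤ x) (hxq : x ≤ q) :
    max (x * 0 - p * ((q - x) * (q - 0))) 0 = 0 := by
  apply max_eq_right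
  have : 0 ≤ p * ((q - x) * (q - 0)) := mul_nonneg hp (mul_nonneg (by linarith) (by linarith))
  linarith

/-- The form `φ(x,y) = xy − p(q−x)(q−y)` is monotone in `x` for `0 ≤ y ≤ q`. [this work] -/
theorem form_mono_left {p q x₁ x₂ y : ℝ} (hp : 0 ≤ p) (hx : x₁ ≤ x₂) (hy0 : 0 ≤ y) (hyq : y ≤ q) :
    x₁ * y - p * ((q - x₁) * (q - y)) ≤ x₂ * y - p * ((q - x₂) * (q - y)) := by
  have h : x₂ * y - p * ((q - x₂) * (q - y)) - (x₁ * y - p * ((q - x₁) * (q - y))) = (x₂ - x₁) * (y + p * (q - y)) := by ring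
  have : 0 ≤ (x₂ - x₁) * (y + p * (q - y)) := mul_nonneg (by linarith) (by nlinarith)
  linarith

/-- `K` is monotone in the first variable. [this work] -/
theorem kernel_mono_left {p q x₁ x₂ y : ℝ} (hp : 0 ≤ p) (hx : x₁ ≤ x₂) (hy0 : 0 ≤ y) (hyq : y ≤ q) :
    max (x₁ * y - p * ((q - x₁) * (q - y))) 0 ≤ max (x₂ * y - p * ((q - x₂) * (q - y))) 0 :=
  max_le_max (form_mono_left hp hx hy0 hyq) le_rfl

/-- `K` is monotone in the second variable. [this work] -/
theorem kernel_mono_right {p q x y₁ y₂ : ℝ} (hp : 0 ≤ p) (hy : y₁ ≤ y₂) (hx0 : 0 ≤ x) (hxq : x ≤ q) :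
    max (x * y₁ - p * ((q - x) * (q - y₁))) 0 ≤ max (x * y₂ - p * ((q - x) * (q - y₂))) 0 := by
  have e1 : x * y₁ - p * ((q - x) * (q - y₁)) = y₁ * x - p * ((q - y₁) * (q - x)) := by ring
  have e2 : x * y₂ - p * ((q - x) * (q - y₂)) = y₂ * x - p * ((q - y₂) * (q - x)) := by ring
  rw [e1, e2]
  exact kernel_mono_left hp hy hx0 hxq

/-- Positive parts of a 2-increasing, monotone array are 2-increasing:  if `a₁₂ ≤ a₂₂`, `a₂₁ ≤ a₂₂` and `a₁₂ + a₂₁ ≤ a₁₁ + a₂₂` then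
`a₂₁⁺ − a₁₁⁺ ≤ a₂₂⁺ − a₁₂⁺`. [folklore] -/
theorem max_two_incr {a₁₁ a₁₂ a₂₁ a₂₂ : ℝ} (h1 : a₁₂ ≤ a₂₂) (h2 : a₂₁ ≤ a₂₂) (h3 : a₁₂ + a₂₁ ≤ a₁₁ + a₂₂) :
    max a₂₁ 0 - max a₁₁ 0 ≤ max a₂₂ 0 - max a₁₂ 0 := by
  have m11 : a₁₁ ≤ max a₁₁ 0 := le_max_left _ _
  have m11' : 0 ≤ max a₁₁ 0 := le_max_right _ _
  have m22 : a₂₂ ≤ max a₂₂ 0 := le_max_left _ _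
  have m22' : 0 ≤ max a₂₂ 0 := le_max_right _ _
  rcases le_or_gt a₁₂ 0 with h12 | h12 <;> rcases le_or_gt a₂₁ 0 with h21 | h21
  · rw [max_eq_right h12, max_eq_right h21]; linarith
  · rw [max_eq_right h12, max_eq_left h21.le]; linarith
  · rw [max_eq_left h12.le, max_eq_right h21]; linarith
  · rw [max_eq_left h12.le, max_eq_left h21.le]; linarith

/-- `K` is 2-increasing on `[0,q]²` (`0 ≤ p ≤ 1`). [this work] -/
theorem kernel_two_incr {p q x₁ x₂ y₁ y₂ : ℝ} (hp : 0 ≤ p) (hp1 : p ≤ 1) (hx0 : 0 ≤ x₁) (hx : x₁ ≤ x₂) (hxq : x₂ ≤ q)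
    (hy0 : 0 ≤ y₁) (hy : y₁ ≤ y₂) (hyq : y₂ ≤ q) :
    max (x₂ * y₁ - p * ((q - x₂) * (q - y₁))) 0 - max (x₁ * y₁ - p * ((q - x₁) * (q - y₁))) 0 ≤
      max (x₂ * y₂ - p * ((q - x₂) * (q - y₂))) 0 - max (x₁ * y₂ - p * ((q - x₁) * (q - y₂))) 0 := by
  refine max_two_incr ?_ ?_ ?_
  · exact form_mono_left hp hx (by linarith) hyq
  · have e1 : x₂ * y₁ - p * ((q - x₂) * (q - y₁)) = y₁ * x₂ - p * ((q - y₁) * (q - x₂)) := by ring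
    have e2 : x₂ * y₂ - p * ((q - x₂) * (q - y₂)) = y₂ * x₂ - p * ((q - y₂) * (q - x₂)) := by ring
    rw [e1, e2]; exact form_mono_left hp hy (by linarith) hxq
  · have h : x₁ * y₁ - p * ((q - x₁) * (q - y₁)) + (x₂ * y₂ - p * ((q - x₂) * (q - y₂)))
        - (x₁ * y₂ - p * ((q - x₁) * (q - y₂)) + (x₂ * y₁ - p * ((q - x₂) * (q - y₁)))) =
        (1 - p) * ((x₂ - x₁) * (y₂ - y₁)) := by ring
    have : 0 ≤ (1 - p) * ((x₂ - x₁) * (y₂ - y₁)) := mul_nonneg (by linarith) (mul_nonneg (by linarith) (by linarith))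
    linarith

/-- `K(x,y) ≤ xy` on `[0,q]²`. [this work] -/
theorem kernel_le_mul {p q x y : ℝ} (hp : 0 ≤ p) (hx0 : 0 ≤ x) (hxq : x ≤ q) (hy0 : 0 ≤ y) (hyq : y ≤ q) :
    max (x * y - p * ((q - x) * (q - y))) 0 ≤ x * y := by
  refine max_le ?_ (mul_nonneg hx0 hy0)
  have : 0 ≤ p * ((q - x) * (q - y)) := mul_nonneg hp (mul_nonneg (by linarith) (by linarith))
  linarith

/-- The defect `xy − K(x,y) ≤ p(q−x)(q−y)`. [this work] -/
theorem mul_sub_kernel_le (p q x y : ℝ) :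
    x * y - max (x * y - p * ((q - x) * (q - y))) 0 ≤ p * ((q - x) * (q - y)) := by
  have : x * y - p * ((q - x) * (q - y)) ≤ max (x * y - p * ((q - x) * (q - y))) 0 := le_max_left _ _
  linarith

/-- The defect with support indicators: if `a, a' ∈ {0,1}`, `0 ≤ f ≤ q a`, `0 ≤ f' ≤ q a'` (so `f = 0` off the support), then
`f f' − K(f,f') ≤ p (q a − f)(q a' − f')`. [this work] -/
theorem mul_sub_kernel_le' {p q a a' f f' : ℝ} (hp : 0 ≤ p) (hq : 0 ≤ q) (ha : a = 0 ∨ a = 1) (ha' : a' = 0 ∨ a' = 1)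
    (hf0 : 0 ≤ f) (hfa : f ≤ q * a) (hf0' : 0 ≤ f') (hfa' : f' ≤ q * a') :
    f * f' - max (f * f' - p * ((q - f) * (q - f'))) 0 ≤ p * ((q * a - f) * (q * a' - f')) := by
  rcases ha with rfl | rfl
  · have hf : f = 0 := le_antisymm (by simpa using hfa) hf0
    subst hf
    have hfq' : f' ≤ q := by rcases ha' with rfl | rfl <;> nlinarith
    rw [kernel_zero_left hp hf0' hfq']
    have : 0 ≤ p * ((q * 0 - 0) * (q * a' - f')) := by
      rcases ha' with rfl | rfl
      · have : f' = 0 := le_antisymm (by simpa using hfa') hf0'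
        subst this; simp
      · exact mul_nonneg hp (mul_nonneg (by simp) (by linarith))
    linarith
  · rcases ha' with rfl | rfl
    · have hf' : f' = 0 := le_antisymm (by simpa using hfa') hf0'
      subst hf'
      rw [kernel_zero_right hp hf0 (by linarith)]
      have : 0 ≤ p * ((q * 1 - f) * (q * 0 - 0)) := by simp
      linarith
    · simpa using mul_sub_kernel_le p q f f'

/-! ### Pointwise consequences of Harris' inequality on the block -/

/-- The support case analysis: `a ∈ {0,1}`, `0 ≤ f ≤ q a` forces `f = 0` when `a = 0`. [folklore] -/
theorem eq_zero_of_le_mul_zero {q f : ℝ} (hf0 : 0 ≤ f) (hfa : f ≤ q * 0) : f = 0 :=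
  le_antisymm (by simpa using hfa) hf0

/-- **`K(f,f') ≤ q·h`** from Harris on the block: `(pa+f)(pa'+f') ≤ p·aa' + h`, `p + q = 1`. [this work] -/
theorem hb_kernel_le {p q a a' f f' h : ℝ} (hp : 0 ≤ p) (hq : 0 ≤ q) (hpq : p + q = 1) (ha : a = 0 ∨ a = 1)
    (ha' : a' = 0 ∨ a' = 1) (hf0 : 0 ≤ f) (hfa : f ≤ q * a) (hf0' : 0 ≤ f') (hfa' : f' ≤ q * a') (hh0 : 0 ≤ h)
    (hB : (p * a + f) * (p * a' + f') ≤ p * (a * a') + h) :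
    max (f * f' - p * ((q - f) * (q - f'))) 0 ≤ q * h := by
  refine max_le ?_ (mul_nonneg hq hh0)
  rcases ha with rfl | rfl
  · have hf : f = 0 := eq_zero_of_le_mul_zero hf0 hfa
    subst hf
    have hfq' : f' ≤ q := by rcases ha' with rfl | rfl <;> nlinarith
    nlinarith [mul_nonneg hp (mul_nonneg hq (sub_nonneg.2 hfq')), mul_nonneg hq hh0]
  · rcases ha' with rfl | rfl
    · have hf' : f' = 0 := eq_zero_of_le_mul_zero hf0' hfa'
      subst hf'
      have hfq : f ≤ q := by linarith
      nlinarith [mul_nonneg hp (mul_nonneg (sub_nonneg.2 hfq) hq), mul_nonneg hq hh0]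
    · -- `a = a' = 1`: `(p+f)(p+f') ≤ p + h` and `q = 1 - p`
      have hq' : q = 1 - p := by linarith
      subst hq'
      nlinarith

/-- **`(ff' − qh)⁺ ≤ p·aa'(q−f)(q−f')`** from Harris on the block. [this work] -/
theorem hb_excess_le {p q a a' f f' h : ℝ} (hp : 0 ≤ p) (hq : 0 ≤ q) (hpq : p + q = 1) (ha : a = 0 ∨ a = 1)
    (ha' : a' = 0 ∨ a' = 1) (hf0 : 0 ≤ f) (hfa : f ≤ q * a) (hf0' : 0 ≤ f') (hfa' : f' ≤ q * a') (hh0 : 0 ≤ h)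
    (hB : (p * a + f) * (p * a' + f') ≤ p * (a * a') + h) :
    max (f * f' - q * h) 0 ≤ p * (a * a' * ((q - f) * (q - f'))) := by
  rcases ha with rfl | rfl
  · have hf : f = 0 := eq_zero_of_le_mul_zero hf0 hfa
    subst hf
    rw [max_eq_right (by nlinarith [mul_nonneg hq hh0])]
    simp
  · rcases ha' with rfl | rfl
    · have hf' : f' = 0 := eq_zero_of_le_mul_zero hf0' hfa'
      subst hf'
      rw [max_eq_right (by nlinarith [mul_nonneg hq hh0])]
      simp
    · have hq' : q = 1 - p := by linarith
      subst hq'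
      refine max_le ?_ ?_
      · nlinarith
      · have h1 : 0 ≤ (1 - p) - f := by linarith
        have h2 : 0 ≤ (1 - p) - f' := by linarith
        have := mul_nonneg hp (mul_nonneg h1 h2)
        simpa using this

/-- **`aa'(q−f)(q−f') ≤ q·aa' + h − a f' − a' f`** from Harris on the block. [this work] -/
theorem hb_m0_ge {p q a a' f f' h : ℝ} (hp : 0 ≤ p) (hpq : p + q = 1) (ha : a = 0 ∨ a = 1)
    (ha' : a' = 0 ∨ a' = 1) (hf0 : 0 ≤ f) (hfa : f ≤ q * a) (hf0' : 0 ≤ f') (hfa' : f' ≤ q * a') (hh0 : 0 ≤ h)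
    (hhf : h ≤ f) (hhf' : h ≤ f')
    (hB : (p * a + f) * (p * a' + f') ≤ p * (a * a') + h) :
    a * a' * ((q - f) * (q - f')) ≤ q * (a * a') + h - a * f' - a' * f := by
  rcases ha with rfl | rfl
  · have hf : f = 0 := eq_zero_of_le_mul_zero hf0 hfa
    subst hf
    have : h = 0 := le_antisymm hhf hh0
    subst this
    simp
  · rcases ha' with rfl | rfl
    · have hf' : f' = 0 := eq_zero_of_le_mul_zero hf0' hfa'
      subst hf'
      have : h = 0 := le_antisymm hhf' hh0
      subst this
      simp
    · have hq' : q = 1 - p := by linarith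
      subst hq'
      -- `(q-f)(q-f') = q·m₀ + (ff' - qh)` and `ff' - qh ≤ p (q-f)(q-f')`, so `q[(q-f)(q-f') - m₀] ≤ 0`
      by_cases hq0 : 1 - p = 0
      · have hp1 : p = 1 := by linarith
        subst hp1
        have hf : f = 0 := by linarith
        have hf' : f' = 0 := by linarith
        subst hf; subst hf'
        have : h = 0 := le_antisymm hhf hh0
        subst this; simp
      · have hqpos : 0 < 1 - p := lt_of_le_of_ne (by linarith) (Ne.symm hq0)
        have key : (1 - p) * (((1 - p) - f) * ((1 - p) - f') - ((1 - p) + h - f' - f)) ≤ 0 := by nlinarith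
        have := (mul_nonpos_iff.1 key)
        rcases this with ⟨_, h2⟩ | ⟨h1, _⟩
        · simp only [one_mul, mul_one]; linarith
        · exact absurd h1 (not_le.2 hqpos)

end Summit.CriticalPhenomena.PercolationContinuityZ3.Theorems.SahiE3BlockKernel
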